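import Summits.AnomalousDissipation.AnomalousDissipation.Theorems.SawtoothPulseCascadeK1LocalisedCascadeCornerTraceTerm

/-!
# K1loc, line `Spectral` / thin start — helper: THE CORNER-TRACE BOUND IN COEFFICIENT SPACE (S-D constants, «CT» 3/3)

Helper file of the prover lane on the crux `K1LocalisedCascade` (stmt-AnomalousDissipation-19491), route
`SawtoothPulseCascade` (S-D fibre ledger; arbiter A23-7 (3): corner-trace track, improvement over the Osc grade).  For the exact
`N`-tooth chirp `g₀` with lobe `λ = L₂ > 0` and a trigonometric polynomial `T(y) = Σ_{l∈S} c_l e_l(y)` with `|l| ≤ L` on `S`, the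
window energy of the product, `Σ_{k∈W} |(g₀T)^(k)|² = Σ_{k∈W} |Σ_l c_l ĝ₀(k−l)|²`, is bounded for windows `|k| + L + D ≤ L₂` by
**`cornerTrace_sum_sq_le`** —
`≤ (3Nσ/π²)·(Σ_{r<N}|T((4r−1)/(4N))|² + Σ_{r<N}|T((4r+1)/(4N))|²) + (12N²L²Mσ/(π²D²))·Σ_l|c_l|²`, `σ = 1/(D+L)² + 1/(N(D+L))`,
`M` = a bound for the number of `l ∈ S` in one residue class mod `N`.  Mechanism (no integration by parts): the closed form
`ĝ₀(Nq) = sin(π(λ+Nq)/(2N))·(N/π)(1/(λ+Nq) + 1/(λ−Nq))` (`…CornerTraceTools`, `…ChirpCoeff`), the split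
`1/(λ±(k−l)) = 1/(λ±k) + O(|l|/((λ±k)D))`, the sums `Σ_{l≡k (N)} c_l e^{∓iπl/(2N)}` whose squares add up (finite Parseval) to
`(1/N)·Σ_r |T(r/N ∓ 1/(4N))|²` — the TRACE of `T` on the corner lines — and `Σ_{k≡ρ (N)} 1/(λ±k)² ≤ σ`.
Summed over the fibres of a half-step with `Σ_n |T_n(y)|² ≤ ‖k_χ‖₁²` this is the input-free junk `≈ 6N‖k_χ‖₁²/(π²(D+L))` per window
(vs `≈ 32N‖k_χ‖₁²A/(πD)·…` of the landed grades).  The per-frequency estimate is `…CornerTraceTerm.cornerTrace_term_sq_le`; this file does the sum over the window (residue classes, `…CornerTraceTools`).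
No definitions; nothing about the crux. [cite: Grafakos2014, Prop. 3.1.2 (5), §3.1.3] [problem: turb]
-/

-- `Summit.<Summit>.<Problem>`: single-conjunct summit, the duplicate namespace segment is deliberate.
set_option linter.dupNamespace false

noncomputable section

namespace Summit.AnomalousDissipation.AnomalousDissipation.Theorems.SawtoothPulseCascade.K1Window

open MeasureTheory Set Filter Topology Function Complex AddCircle
open scoped Real
open Literature.Analysis Literature.Analysis.FunctionSpaces Literature.Analysis.FunctionSpaces.Torus Literature.Analysis.FluidPDE
open Literature.Analysis.FluidPDE.SawtoothCascade
open Summit.AnomalousDissipation.AnomalousDissipation.Theorems.SawtoothPulseCascade.K1Start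

/-! ## The corner-trace bound, summed over the window -/

set_option maxHeartbeats 400000 in
/-- **THE CORNER-TRACE BOUND** (see the file header).  `N ≥ 1`, lobe `λ = L₂`, `g₀` the exact `N`-tooth chirp with lobe `λ`,
coefficients `c` on a finite `S` with `|l| ≤ L` and at most `M` elements per residue class mod `N`, window `W` with
`|k| + L + D ≤ L₂` (`D ≥ 1`).  With `T(y) = Σ_{l∈S} c_l e^{2πily}` and `σ = 1/(D+L)² + 1/(N(D+L))`:
`Σ_{k∈W} |Σ_{l∈S} c_l ĝ₀(k−l)|² ≤ (3Nσ/π²)(Σ_{r<N}|T((4r−1)/(4N))|² + Σ_{r<N}|T((4r+1)/(4N))|²) + (12N²L²Mσ/(π²D²))Σ_{l∈S}|c_l|²`.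
[cite: Grafakos2014, Prop. 3.1.2 (5), §3.1.3] -/
theorem cornerTrace_sum_sq_le {N : ℕ} (hN : 0 < N) {L₂ : ℕ} {g₀ : UnitAddCircle → ℂ}
    (hg₀ : ∀ t : ℝ, g₀ (t : UnitAddCircle) =
      Complex.exp (-(2 * π * I * ((L₂ : ℤ) : ℂ) * ((tri (2 * π * N * t) / (2 * π * N) : ℝ) : ℂ))))
    (c : ℤ → ℂ) (S : Finset ℤ) {L D : ℕ} (hD : 0 < D) (hS : ∀ l ∈ S, |l| ≤ L) {M : ℝ}
    (hM : ∀ k : ℤ, (((S.filter fun l => (N : ℤ) ∣ k - l).card : ℕ) : ℝ) ≤ M)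
    (W : Finset ℤ) (hW : ∀ k ∈ W, |k| + L + D ≤ (L₂ : ℤ)) :
    ∑ k ∈ W, ‖∑ l ∈ S, c l * fourierCoeff g₀ (k - l)‖ ^ 2 ≤
      3 * N * (1 / ((D : ℝ) + L) ^ 2 + 1 / (N * ((D : ℝ) + L))) / π ^ 2 *
          (∑ r ∈ Finset.range N, ‖∑ l ∈ S, c l * Complex.exp (2 * π * I * l * ((4 * (r : ℝ) - 1) / (4 * N)))‖ ^ 2 +
            ∑ r ∈ Finset.range N, ‖∑ l ∈ S, c l * Complex.exp (2 * π * I * l * ((4 * (r : ℝ) + 1) / (4 * N)))‖ ^ 2) +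
        12 * N ^ 2 * L ^ 2 * M * (1 / ((D : ℝ) + L) ^ 2 + 1 / (N * ((D : ℝ) + L))) / (π ^ 2 * D ^ 2) *
          ∑ l ∈ S, ‖c l‖ ^ 2 := by
  classical
  have hπ : 0 < π := Real.pi_pos
  have hNr : (0 : ℝ) < N := by exact_mod_cast hN
  have hNz : (0 : ℤ) < N := by exact_mod_cast hN
  have hDr : (0 : ℝ) < D := by exact_mod_cast hD
  have hM0 : 0 ≤ M := le_trans (Nat.cast_nonneg _) (hM 0)
  set σ : ℝ := 1 / ((D : ℝ) + L) ^ 2 + 1 / (N * ((D : ℝ) + L)) with hσ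
  have hσ0 : 0 ≤ σ := by positivity
  have hkpos : ∀ k ∈ W, 0 < (L₂ : ℝ) + k ∧ 0 < (L₂ : ℝ) - k := by
    intro k hk
    have h1 := hW k hk
    have h1' : |((k : ℤ) : ℝ)| + L + D ≤ L₂ := by have h := h1; exact_mod_cast h
    have := le_abs_self ((k : ℤ) : ℝ); have := neg_abs_le ((k : ℤ) : ℝ)
    have : (0 : ℝ) ≤ L := Nat.cast_nonneg _
    constructor <;> linarith
  set ω : ℤ → ℂ := fun x => Complex.exp (π * I * x / (2 * N)) with hω
  set ω' : ℤ → ℂ := fun x => Complex.exp (-(π * I * x / (2 * N))) with hω'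
  set Φ₀ : ℤ → ℝ := fun k => (N : ℝ) / (π * ((L₂ : ℝ) + k)) + (N : ℝ) / (π * ((L₂ : ℝ) - k)) with hΦ₀
  set Sk : ℤ → Finset ℤ := fun k => S.filter fun l => (N : ℤ) ∣ k - l with hSk
  set A : ℤ → ℂ := fun k => ∑ l ∈ Sk k, c l * ω' l with hA
  set A' : ℤ → ℂ := fun k => ∑ l ∈ Sk k, c l * ω l with hA'
  set e : ℤ → ℝ := fun k => ∑ l ∈ Sk k, ‖c l‖ ^ 2 with he
  have hsqX : ∀ k ∈ W, ‖∑ l ∈ S, c l * fourierCoeff g₀ (k - l)‖ ^ 2 ≤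
      3 * (Φ₀ k / 2) ^ 2 * (‖A k‖ ^ 2 + ‖A' k‖ ^ 2 + 4 * (L : ℝ) ^ 2 * M / D ^ 2 * e k) :=
    cornerTrace_term_sq_le hN hg₀ c S hD hS hM W hW
  -- Step 4: sum over `k`, grouping by `k mod N`
  set t : Finset ℤ := (Finset.range N).image (fun n : ℕ => (n : ℤ)) with ht
  have hmod_mem : ∀ k : ℤ, k % (N : ℤ) ∈ t := by
    intro k
    refine Finset.mem_image.mpr ⟨(k % (N : ℤ)).toNat, Finset.mem_range.mpr ?_, ?_⟩
    · have h1 := Int.emod_nonneg k hNz.ne'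
      have h2 := Int.emod_lt_of_pos k hNz
      omega
    · exact Int.toNat_of_nonneg (Int.emod_nonneg k hNz.ne')
  -- the residue set of `k` depends only on `k mod N`
  have hSk_mod : ∀ k ρ : ℤ, k % (N : ℤ) = ρ % (N : ℤ) → Sk k = Sk ρ := by
    intro k ρ hkρ
    simp only [hSk]
    refine Finset.filter_congr fun l _ => ?_
    rw [← Int.modEq_iff_dvd, ← Int.modEq_iff_dvd]
    show l % (N : ℤ) = k % (N : ℤ) ↔ l % (N : ℤ) = ρ % (N : ℤ)
    rw [hkρ]
  set Fk : ℤ → ℝ := fun k => ‖A k‖ ^ 2 + ‖A' k‖ ^ 2 + 4 * (L : ℝ) ^ 2 * M / D ^ 2 * e k with hFk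
  have hFk0 : ∀ k, 0 ≤ Fk k := fun k => by
    simp only [hFk, he]
    have : 0 ≤ ∑ l ∈ Sk k, ‖c l‖ ^ 2 := Finset.sum_nonneg fun _ _ => sq_nonneg _
    positivity
  have hFk_mod : ∀ k : ℤ, Fk k = Fk (k % (N : ℤ)) := by
    intro k
    have h := hSk_mod k (k % (N : ℤ)) (Int.emod_emod_of_dvd k (dvd_refl _)).symm
    simp only [hFk, hA, hA', he, h]
  -- the `Φ₀²` sums over one residue class
  have hΦsum : ∀ ρ ∈ t, ∑ k ∈ W.filter (fun k => k % (N : ℤ) = ρ), Φ₀ k ^ 2 ≤ 4 * (N : ℝ) ^ 2 * σ / π ^ 2 := by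
    intro ρ _
    set Wρ := W.filter (fun k => k % (N : ℤ) = ρ) with hWρ
    have hmodW : ∀ k ∈ Wρ, ∀ k' ∈ Wρ, k ≡ k' [ZMOD N] := by
      intro k hk k' hk'
      have h1 := (Finset.mem_filter.mp hk).2
      have h2 := (Finset.mem_filter.mp hk').2
      show k % (N : ℤ) = k' % (N : ℤ)
      rw [h1, h2]
    -- `Σ 1/(L₂ + k)²` and `Σ 1/(L₂ − k)²`
    have hplus : ∑ k ∈ Wρ, 1 / ((L₂ : ℝ) + k) ^ 2 ≤ σ := by
      have hinj : Set.InjOn (fun k : ℤ => (L₂ : ℤ) + k) Wρ := fun a _ b _ h => by simpa using h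
      have hs := sum_inv_sq_le_of_modEq hN (Wρ.image fun k => (L₂ : ℤ) + k) ((D : ℤ) + L) (by positivity)
        (fun u hu => by
          obtain ⟨k, hk, rfl⟩ := Finset.mem_image.mp hu
          have := hW k (Finset.mem_filter.mp hk).1
          have := neg_abs_le k
          omega)
        (fun u hu v hv => by
          obtain ⟨k, hk, rfl⟩ := Finset.mem_image.mp hu
          obtain ⟨k', hk', rfl⟩ := Finset.mem_image.mp hv
          exact (hmodW k hk k' hk').add_left _)
      rw [Finset.sum_image hinj] at hs
      push_cast at hs
      simpa only [hσ] using hs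
    have hminus : ∑ k ∈ Wρ, 1 / ((L₂ : ℝ) - k) ^ 2 ≤ σ := by
      have hinj : Set.InjOn (fun k : ℤ => (L₂ : ℤ) - k) Wρ := fun a _ b _ h => by simpa using h
      have hs := sum_inv_sq_le_of_modEq hN (Wρ.image fun k => (L₂ : ℤ) - k) ((D : ℤ) + L) (by positivity)
        (fun u hu => by
          obtain ⟨k, hk, rfl⟩ := Finset.mem_image.mp hu
          have := hW k (Finset.mem_filter.mp hk).1
          have := le_abs_self k
          omega)
        (fun u hu v hv => by
          obtain ⟨k, hk, rfl⟩ := Finset.mem_image.mp hu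
          obtain ⟨k', hk', rfl⟩ := Finset.mem_image.mp hv
          exact (hmodW k hk k' hk').sub_left _)
      rw [Finset.sum_image hinj] at hs
      push_cast at hs
      simpa only [hσ] using hs
    have hpt : ∀ k ∈ Wρ, Φ₀ k ^ 2 ≤ 2 * (N : ℝ) ^ 2 / π ^ 2 * (1 / ((L₂ : ℝ) + k) ^ 2 + 1 / ((L₂ : ℝ) - k) ^ 2) := by
      intro k hk
      obtain ⟨hp1, hp2⟩ := hkpos k (Finset.mem_filter.mp hk).1
      simp only [hΦ₀]
      have h2 : ((N : ℝ) / (π * ((L₂ : ℝ) + k)) + (N : ℝ) / (π * ((L₂ : ℝ) - k))) ^ 2 ≤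
          2 * (((N : ℝ) / (π * ((L₂ : ℝ) + k))) ^ 2 + ((N : ℝ) / (π * ((L₂ : ℝ) - k))) ^ 2) := by
        nlinarith [sq_nonneg ((N : ℝ) / (π * ((L₂ : ℝ) + k)) - (N : ℝ) / (π * ((L₂ : ℝ) - k)))]
      have e1 : ((N : ℝ) / (π * ((L₂ : ℝ) + k))) ^ 2 = (N : ℝ) ^ 2 / π ^ 2 * (1 / ((L₂ : ℝ) + k) ^ 2) := by
        field_simp
      have e2 : ((N : ℝ) / (π * ((L₂ : ℝ) - k))) ^ 2 = (N : ℝ) ^ 2 / π ^ 2 * (1 / ((L₂ : ℝ) - k) ^ 2) := by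
        field_simp
      calc ((N : ℝ) / (π * ((L₂ : ℝ) + k)) + (N : ℝ) / (π * ((L₂ : ℝ) - k))) ^ 2
          ≤ 2 * (((N : ℝ) / (π * ((L₂ : ℝ) + k))) ^ 2 + ((N : ℝ) / (π * ((L₂ : ℝ) - k))) ^ 2) := h2
        _ = 2 * (N : ℝ) ^ 2 / π ^ 2 * (1 / ((L₂ : ℝ) + k) ^ 2 + 1 / ((L₂ : ℝ) - k) ^ 2) := by
          rw [e1, e2]; ring
    calc ∑ k ∈ Wρ, Φ₀ k ^ 2 ≤ ∑ k ∈ Wρ, 2 * (N : ℝ) ^ 2 / π ^ 2 * (1 / ((L₂ : ℝ) + k) ^ 2 + 1 / ((L₂ : ℝ) - k) ^ 2) :=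
          Finset.sum_le_sum hpt
      _ = 2 * (N : ℝ) ^ 2 / π ^ 2 * (∑ k ∈ Wρ, 1 / ((L₂ : ℝ) + k) ^ 2 + ∑ k ∈ Wρ, 1 / ((L₂ : ℝ) - k) ^ 2) := by
          rw [← Finset.sum_add_distrib, Finset.mul_sum]
      _ ≤ 2 * (N : ℝ) ^ 2 / π ^ 2 * (σ + σ) := by gcongr
      _ = 4 * (N : ℝ) ^ 2 * σ / π ^ 2 := by ring
  -- regroup the `k`-sum
  have hgroup : ∑ k ∈ W, ‖∑ l ∈ S, c l * fourierCoeff g₀ (k - l)‖ ^ 2 ≤ 3 * (N : ℝ) ^ 2 * σ / π ^ 2 * ∑ ρ ∈ t, Fk ρ := by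
    calc ∑ k ∈ W, ‖∑ l ∈ S, c l * fourierCoeff g₀ (k - l)‖ ^ 2 ≤ ∑ k ∈ W, 3 * (Φ₀ k / 2) ^ 2 * Fk k :=
          Finset.sum_le_sum fun k hk => hsqX k hk
      _ = ∑ ρ ∈ t, ∑ k ∈ W.filter (fun k => k % (N : ℤ) = ρ), 3 * (Φ₀ k / 2) ^ 2 * Fk k :=
          (Finset.sum_fiberwise_of_maps_to (fun k _ => hmod_mem k) _).symm
      _ = ∑ ρ ∈ t, (3 / 4 * Fk ρ) * ∑ k ∈ W.filter (fun k => k % (N : ℤ) = ρ), Φ₀ k ^ 2 := by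
          refine Finset.sum_congr rfl fun ρ hρ => ?_
          rw [Finset.mul_sum]
          refine Finset.sum_congr rfl fun k hk => ?_
          have hkρ : k % (N : ℤ) = ρ := (Finset.mem_filter.mp hk).2
          obtain ⟨n, _, rfl⟩ := Finset.mem_image.mp hρ
          have hρρ : ((n : ℤ)) % (N : ℤ) = (n : ℤ) := by
            rw [← hkρ]; exact Int.emod_emod_of_dvd k (dvd_refl _)
          rw [hFk_mod k, hkρ]
          ring
      _ ≤ ∑ ρ ∈ t, (3 / 4 * Fk ρ) * (4 * (N : ℝ) ^ 2 * σ / π ^ 2) :=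
          Finset.sum_le_sum fun ρ hρ => mul_le_mul_of_nonneg_left (hΦsum ρ hρ) (by have := hFk0 ρ; positivity)
      _ = 3 * (N : ℝ) ^ 2 * σ / π ^ 2 * ∑ ρ ∈ t, Fk ρ := by rw [Finset.mul_sum]; refine Finset.sum_congr rfl fun ρ _ => ?_; ring
  -- the residue sets as fibres of `l ↦ l mod N`
  have hSk_eq : ∀ n ∈ Finset.range N, Sk (n : ℤ) = S.filter (fun l => l % (N : ℤ) = n) := by
    intro n hn
    simp only [hSk]
    refine Finset.filter_congr fun l _ => ?_
    rw [← Int.modEq_iff_dvd]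
    show l % (N : ℤ) = (n : ℤ) % (N : ℤ) ↔ l % (N : ℤ) = n
    rw [Int.emod_eq_of_lt (a := (n : ℤ)) (b := (N : ℤ)) (Int.natCast_nonneg n)
      (by exact_mod_cast Finset.mem_range.mp hn)]
  -- `Σ_ρ e ρ = Σ_l ‖c_l‖²`
  have hesum : ∑ ρ ∈ t, e ρ = ∑ l ∈ S, ‖c l‖ ^ 2 := by
    rw [ht, Finset.sum_image (fun a _ b _ h => by exact_mod_cast h)]
    have h := Finset.sum_fiberwise_of_maps_to (s := S) (t := Finset.range N) (g := fun l : ℤ => (l % (N : ℤ)).toNat)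
      (fun l _ => by
        have h1 := Int.emod_nonneg l hNz.ne'
        have h2 := Int.emod_lt_of_pos l hNz
        exact Finset.mem_range.mpr (by omega)) (fun l => ‖c l‖ ^ 2)
    rw [← h]
    refine Finset.sum_congr rfl fun n hn => ?_
    simp only [he]
    rw [hSk_eq n hn]
    refine Finset.sum_congr (Finset.filter_congr fun l _ => ?_) fun _ _ => rfl
    have h1 := Int.emod_nonneg l hNz.ne'
    constructor
    · intro h0; rw [h0]; simp
    · intro h0; have := congrArg (fun x : ℕ => (x : ℤ)) h0; rw [Int.toNat_of_nonneg h1] at this; exact this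
  -- Parseval for `A` and `A'`
  have hexp_mod : ∀ (l : ℤ) (n r : ℕ), l % (N : ℤ) = n →
      Complex.exp (2 * π * I * l * r / N) = Complex.exp (2 * π * I * n * r / N) := by
    intro l n r hln
    have hNc : (N : ℂ) ≠ 0 := by exact_mod_cast hN.ne'
    have hl : l = N * (l / N) + n := by have h := Int.emod_add_mul_ediv l N; rw [hln] at h; linarith
    conv_lhs => rw [hl]
    rw [show (2 * π * I * (((N : ℤ) * (l / N) + n : ℤ) : ℂ) * r / N : ℂ) =
        2 * π * I * n * r / N + ((l / N) * r : ℤ) * (2 * π * I) by push_cast; field_simp; ring,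
      Complex.exp_add, Complex.exp_int_mul_two_pi_mul_I, mul_one]
  have hParseval : ∀ (w : ℤ → ℂ) (y₀ : ℝ), (∀ l : ℤ, w l = Complex.exp (2 * π * I * l * y₀)) →
      ∑ ρ ∈ t, ‖∑ l ∈ Sk ρ, c l * w l‖ ^ 2 =
        1 / N * ∑ r ∈ Finset.range N, ‖∑ l ∈ S, c l * Complex.exp (2 * π * I * l * ((r : ℝ) / N + y₀))‖ ^ 2 := by
    intro w y₀ hw
    rw [ht, Finset.sum_image (fun a _ b _ h => by exact_mod_cast h)]
    have hP := dft_parseval_range hN (fun n => ∑ l ∈ Sk (n : ℤ), c l * w l)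
    -- identify the DFT with the corner values of `T`
    have hT : ∀ r ∈ Finset.range N, ∑ n ∈ Finset.range N, Complex.exp (2 * π * I * n * r / N) *
        (∑ l ∈ Sk (n : ℤ), c l * w l) = ∑ l ∈ S, c l * Complex.exp (2 * π * I * l * ((r : ℝ) / N + y₀)) := by
      intro r _
      have h := Finset.sum_fiberwise_of_maps_to (s := S) (t := Finset.range N) (g := fun l : ℤ => (l % (N : ℤ)).toNat)
        (fun l _ => by
          have h1 := Int.emod_nonneg l hNz.ne'
          have h2 := Int.emod_lt_of_pos l hNz
          exact Finset.mem_range.mpr (by omega)) (fun l => c l * Complex.exp (2 * π * I * l * ((r : ℝ) / N + y₀)))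
      rw [← h]
      refine Finset.sum_congr rfl fun n hn => ?_
      rw [hSk_eq n hn, Finset.mul_sum]
      have hfil : S.filter (fun l => (l % (N : ℤ)).toNat = n) = S.filter (fun l => l % (N : ℤ) = n) := by
        refine Finset.filter_congr fun l _ => ?_
        have h1 := Int.emod_nonneg l hNz.ne'
        constructor
        · intro h0; have := congrArg (fun x : ℕ => (x : ℤ)) h0; rw [Int.toNat_of_nonneg h1] at this; exact this
        · intro h0; rw [h0]; simp
      rw [hfil]
      refine Finset.sum_congr rfl fun l hl => ?_
      have hln := (Finset.mem_filter.mp hl).2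
      rw [hw l, ← hexp_mod l n r hln, mul_left_comm, ← Complex.exp_add]
      congr 2
      push_cast
      ring
    have hcongr : ∑ r ∈ Finset.range N, ‖∑ n ∈ Finset.range N, Complex.exp (2 * π * I * n * r / N) *
        (∑ l ∈ Sk (n : ℤ), c l * w l)‖ ^ 2 =
        ∑ r ∈ Finset.range N, ‖∑ l ∈ S, c l * Complex.exp (2 * π * I * l * ((r : ℝ) / N + y₀))‖ ^ 2 :=
      Finset.sum_congr rfl fun r hr => by rw [hT r hr]
    rw [hcongr] at hP
    have hNr' : (N : ℝ) ≠ 0 := hNr.ne'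
    field_simp
    linarith [hP]
  have hPA : ∑ ρ ∈ t, ‖A ρ‖ ^ 2 =
      1 / N * ∑ r ∈ Finset.range N, ‖∑ l ∈ S, c l * Complex.exp (2 * π * I * l * ((4 * (r : ℝ) - 1) / (4 * N)))‖ ^ 2 := by
    have h := hParseval ω' (-1 / (4 * N)) (fun l => by simp only [hω']; congr 1; push_cast; ring)
    simp only [hA]
    rw [h]
    congr 1
    refine Finset.sum_congr rfl fun r _ => ?_
    congr 2
    refine Finset.sum_congr rfl fun l _ => ?_
    congr 2
    push_cast
    ring
  have hPA' : ∑ ρ ∈ t, ‖A' ρ‖ ^ 2 =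
      1 / N * ∑ r ∈ Finset.range N, ‖∑ l ∈ S, c l * Complex.exp (2 * π * I * l * ((4 * (r : ℝ) + 1) / (4 * N)))‖ ^ 2 := by
    have h := hParseval ω (1 / (4 * N)) (fun l => by simp only [hω]; congr 1; push_cast; ring)
    simp only [hA']
    rw [h]
    congr 1
    refine Finset.sum_congr rfl fun r _ => ?_
    congr 2
    refine Finset.sum_congr rfl fun l _ => ?_
    congr 2
    push_cast
    ring
  -- assemble
  have hFsum : ∑ ρ ∈ t, Fk ρ = ∑ ρ ∈ t, ‖A ρ‖ ^ 2 + ∑ ρ ∈ t, ‖A' ρ‖ ^ 2 +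
      4 * (L : ℝ) ^ 2 * M / D ^ 2 * ∑ ρ ∈ t, e ρ := by
    simp only [hFk, Finset.sum_add_distrib, Finset.mul_sum]
  rw [hFsum, hPA, hPA', hesum] at hgroup
  refine hgroup.trans (le_of_eq ?_)
  field_simp
  ring

end Summit.AnomalousDissipation.AnomalousDissipation.Theorems.SawtoothPulseCascade.K1Window
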